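import Summits.BirchSwinnertonDyer.Rank1Residual.Supersingular.KuriharaTwistRecordBallGeneric
import Summits.BirchSwinnertonDyer.Rank1Residual.Supersingular.KuriharaTwistRecordAssemblyLValues
import HarnessLib

/-!
# Twist records + rounding certificates + an enclosure of the TWISTED `L`-VALUE combination, CLASS-FREE:
# `kuriharaNumber f p n ψ ≠ 0` for every consumer of the cell's Kurihara chains (`p ≥ 5` `CertifiedL` rows
# and the odd-`p` / `p = 3` `CertifiedOddL` rows) — `KuriharaTwistRecordBallGeneric` with `hball ↦ hballL`

Cell `b2b-bsdres`, supersingular family, prover A = unit `b2b-bsdres-x10b` (gen 12).  Topic file; namespace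
`Summit.BirchSwinnertonDyer.Rank1Residual.Supersingular.KuriharaTwist`.  THEOREMS ONLY (compositions by
name); no named fact, no definition, nothing asserted about any curve, nothing booked; marks unchanged.

HONEST FRAMING (run/shared/lean/b2b/bsd-rank1-residual/, verbatim): the goal of the cell is to DELETE the
COMBINATION-SHAPED residual classes of the BSD formula in analytic rank `≤ 1` from PUBLISHED theorems only
and to TYPE the construction-shaped ones; this is not "finishing BSD".

## What this file adds (X6-KURIHARA.md §13)

`KuriharaTwistRecordBallGeneric.lean` (gen 11, p290923) gives `kuriharaNumber f (p^1) n ψ ≠ 0` — the `hδ` of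
EVERY Kurihara consumer in the tree (X6/X7 at `p ≥ 5`; the CONDITIONAL `p = 3` consumers of X6/X7/X8 and of
the additive classes) — from a landed record row, its `validHasse` rounding certificate and the enclosure claim
`hball` about plus-symbol bins.  Here `hball` is replaced by **`hballL`** of
`KuriharaTwistRecordAssemblyLValues` (gen 12): for every family `L_j` of entire continuations of
`L(f, χ_j⁻¹, s)` (`χ_j = e_p(j·m(·))` the bin characters of `ψ`, `j ≠ 0`) and every `k < p`, the recorded
ball contains `D'·c_∞·re(Π_{ℓ∣n}(a_ℓ(E)−2)·L(E,1) + Σ_{j≠0} e_p(−jk)·τ(χ_j)·L_j(1))/(p·Ω⁺_f)` — by the tree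
identity `plusPeriod_mul_binSum_eq` (Birch's formula + character orthogonality + the Hecke relation for
`S_0`).  The price is the surjectivity of the `ψ_ℓ` (primitivity of the `χ_j`), which every downstream
consumer assumes anyway.
* `CertifiedL.kuriharaNumber_ne_zero_of_LValueBall` (`p ≥ 5` rows; `p ≠ 2` suffices);
* `CertifiedOddL.kuriharaNumber_ne_zero_of_LValueBall` (odd `p`, `ν < p` — the `p = 3` KP3 / X8 / X4 rows).
Per pair; NOT a class theorem; nothing booked; at `p = 3` everything downstream stays CONDITIONAL on the
Kim 2025 OPEN binder.

References: `KuriharaTwistRecordBallGeneric.lean` (gen 11), `KuriharaTwistBirch{Char,}.lean`,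
`KuriharaTwistRecordAssemblyLValues.lean` (gen 12); C.-H. Kim, Amer. J. Math. 148 (2026) §1.4.3, Thm. 1.9 (6)
[Kim2022StructureSelmer]; Mazur–Tate–Teitelbaum, Invent. Math. 84 (1986) §I.8 (8.6)
[MazurTateTeitelbaum1986Invent]; J. E. Cremona, *Algorithms* (1997) §2.8 [CremonaAlgorithms1997].
-/

noncomputable section

open scoped Classical MatrixGroups ModularForm

open CongruenceSubgroup WeierstrassCurve Literature.NumberTheory.EllipticCurves
  Literature.NumberTheory.EllipticCurves.ModularForms

namespace Summit.BirchSwinnertonDyer.Rank1Residual.Supersingular.KuriharaTwist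

variable {N : ℕ} [NeZero N] {f : CuspForm (Gamma0 N) 2}
  {W : WeierstrassCurve ℚ} [W.IsElliptic] [W.IsGloballyMinimal]

/-- **`kuriharaNumber ≠ 0` from a `CertifiedL` row, its `RoundingCertifiedHasse` row and an ENCLOSURE OF THE
TWISTED `L`-VALUE COMBINATION** (`p ≠ 2`; the `p ≥ 5` records): `CertifiedL.kuriharaNumber_ne_zero_of_roundingCert`
with `hball ↦ hballL` (+ surjectivity of the `ψ_ℓ`).  Class-free: the `hδ` of every `p ≥ 5` Kurihara consumer.
[cite: Kim2022StructureSelmer, Thm. 1.9 (6) (PDF p. 8)] [cite: MazurTateTeitelbaum1986Invent, §I.8 (8.6)]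
[cite: CremonaAlgorithms1997, §2.8 (2.8.8) (PDF p. 26)] -/
theorem CertifiedL.kuriharaNumber_ne_zero_of_LValueBall {rs : List TwistRecord} (hrs : CertifiedL rs)
    {r : TwistRecord} (hr : r ∈ rs) [Fact r.p.Prime] (hνp : r.primes.length < r.p)
    [NeZero r.n] (hν : r.n.primeFactors.card = r.primes.length)
    (hf : IsNewformOf W f) (hp2 : r.p ≠ 2) (hirr : W.HasIrreducibleModPGaloisRep r.p)
    (hgood : W.HasGoodReductionAtPrime r.p) (hn : Kato.IsKolyvaginProduct W r.p 1 r.n)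
    {cs : List RoundingCert} (hcs : RoundingCertifiedHasse cs) {c : RoundingCert} (hc : c ∈ cs)
    (hcp : c.p = r.p) (hcn : c.n = r.n) (hcden : c.den = r.den) (hcbins : c.bins = r.bins) (hD' : 0 < c.dstar)
    (ψ : (ℓ : ℕ) → (ZMod ℓ)ˣ →* Multiplicative (ZMod (r.p ^ 1)))
    (hψ : ∀ ℓ ∈ r.n.primeFactors, Function.Surjective (ψ ℓ))
    (hballL : ∀ (L : ZMod (r.p ^ 1) → ℂ → ℂ), (∀ j, j ≠ 0 → Differentiable ℂ (L j)) →
      (∀ j, j ≠ 0 → ∀ s : ℂ, 2 < s.re → L j s = twistedLSeries f (binChar r.n ψ j)⁻¹ s) →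
      ∀ k < r.p, ∃ mid rad : ℝ, rad ≤ (c.radNum : ℝ) / 10 ^ c.radExp ∧
        |mid - ((c.binsStar.getD k 0 : ℤ) : ℝ)| ≤ (c.marNum : ℝ) / 10 ^ c.marExp ∧
        |(c.dstar : ℝ) * ((r.components : ℝ) *
          (((∏ ℓ ∈ r.n.primeFactors, ((W.frobeniusTrace ℓ : ℂ) - 2)) * W.entireLFunction 1 +
            ∑ j ∈ (Finset.univ : Finset (ZMod (r.p ^ 1))).erase 0,
              ZMod.stdAddChar (-(j * (k : ZMod (r.p ^ 1)))) *
                (gaussSum (binChar r.n ψ j) (ZMod.stdAddChar (N := r.n)) * L j 1)).re /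
            ((r.p ^ 1 : ℕ) * plusPeriod f))) - mid| ≤ rad) :
    kuriharaNumber f (r.p ^ 1) r.n ψ ≠ 0 :=
  r.kuriharaNumber_ne_zero_of_consistent_of_isNewformOf (hrs.consistent_of_mem hr)
    (hrs.deltaModP_pos_of_mem hr) hνp hν hf hp2 hirr hn ψ
    (r.bins_eq_of_validHasse_of_LValueBall (hcs.validHasse_of_mem hc) hcp hcn hcden hcbins hD' hf hgood
      (coprime_level_of_isKolyvaginProduct hf hn) hp2 hn.squarefree
      (hasGoodReductionAtPrime_of_isKolyvaginProduct hn) ψ hψ hballL)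

/-- **`kuriharaNumber ≠ 0` from a `CertifiedOddL` row (odd `p`, `ν < p` — the `p = 3` records), its
`RoundingCertifiedHasse` row and an enclosure of the twisted `L`-value combination**:
`CertifiedOddL.kuriharaNumber_ne_zero_of_roundingCert` with `hball ↦ hballL` (+ surjectivity of the `ψ_ℓ`).  The
input of the CONDITIONAL `p = 3` consumers (`X8RankZero/RankOne…kim2025_OPEN…`, `X7.bsdp_three_of_kim2025_OPEN_…`,
X6 `GoodThree…`, the X4 `KuriharaUnitAt` shapes); nothing booked. [cite: Kim2022StructureSelmer, §1.4.3 (PDF p. 7)]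
[cite: MazurTateTeitelbaum1986Invent, §I.8 (8.6)] [cite: CremonaAlgorithms1997, §2.8 (2.8.8) (PDF p. 26)] -/
theorem CertifiedOddL.kuriharaNumber_ne_zero_of_LValueBall {rs : List TwistRecord} (hrs : CertifiedOddL rs)
    {r : TwistRecord} (hr : r ∈ rs) [Fact r.p.Prime] [NeZero r.n]
    (hν : r.n.primeFactors.card = r.primes.length)
    (hf : IsNewformOf W f) (hp2 : r.p ≠ 2) (hirr : W.HasIrreducibleModPGaloisRep r.p)
    (hgood : W.HasGoodReductionAtPrime r.p) (hn : Kato.IsKolyvaginProduct W r.p 1 r.n)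
    {cs : List RoundingCert} (hcs : RoundingCertifiedHasse cs) {c : RoundingCert} (hc : c ∈ cs)
    (hcp : c.p = r.p) (hcn : c.n = r.n) (hcden : c.den = r.den) (hcbins : c.bins = r.bins) (hD' : 0 < c.dstar)
    (ψ : (ℓ : ℕ) → (ZMod ℓ)ˣ →* Multiplicative (ZMod (r.p ^ 1)))
    (hψ : ∀ ℓ ∈ r.n.primeFactors, Function.Surjective (ψ ℓ))
    (hballL : ∀ (L : ZMod (r.p ^ 1) → ℂ → ℂ), (∀ j, j ≠ 0 → Differentiable ℂ (L j)) →
      (∀ j, j ≠ 0 → ∀ s : ℂ, 2 < s.re → L j s = twistedLSeries f (binChar r.n ψ j)⁻¹ s) →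
      ∀ k < r.p, ∃ mid rad : ℝ, rad ≤ (c.radNum : ℝ) / 10 ^ c.radExp ∧
        |mid - ((c.binsStar.getD k 0 : ℤ) : ℝ)| ≤ (c.marNum : ℝ) / 10 ^ c.marExp ∧
        |(c.dstar : ℝ) * ((r.components : ℝ) *
          (((∏ ℓ ∈ r.n.primeFactors, ((W.frobeniusTrace ℓ : ℂ) - 2)) * W.entireLFunction 1 +
            ∑ j ∈ (Finset.univ : Finset (ZMod (r.p ^ 1))).erase 0,
              ZMod.stdAddChar (-(j * (k : ZMod (r.p ^ 1)))) *
                (gaussSum (binChar r.n ψ j) (ZMod.stdAddChar (N := r.n)) * L j 1)).re /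
            ((r.p ^ 1 : ℕ) * plusPeriod f))) - mid| ≤ rad) :
    kuriharaNumber f (r.p ^ 1) r.n ψ ≠ 0 := by
  have hnv : r.nonvanishingOdd = true := hrs.nonvanishingOdd_of_mem hr
  have hc' : r.consistentOdd = true ∧ 0 < r.deltaModP := by
    simpa [TwistRecord.nonvanishingOdd, Bool.and_eq_true, decide_eq_true_eq] using hnv
  exact r.kuriharaNumber_ne_zero_of_consistentOdd_of_isNewformOf hc'.1 hc'.2 hν hf hp2 hirr hn ψ
    (r.bins_eq_of_validHasse_of_LValueBall (hcs.validHasse_of_mem hc) hcp hcn hcden hcbins hD' hf hgood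
      (coprime_level_of_isKolyvaginProduct hf hn) hp2 hn.squarefree
      (hasGoodReductionAtPrime_of_isKolyvaginProduct hn) ψ hψ hballL)

end Summit.BirchSwinnertonDyer.Rank1Residual.Supersingular.KuriharaTwist

end
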